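import Summits.Ventures.DiscreteObjects.Hadamard.PrimeSquareOrder
import Summits.Ventures.DiscreteObjects.Hadamard.ElemAbelianRank2_7

/-!
# Hadamard 668 census, family F12 — no signed automorphism of an H(668) of order divisible by `343 = 7³` (kernel)

Framing: lottery ticket; floor = certified bounds/negative ranges.

Cell pub-namedobj (venture DiscreteObjects), target (H), hadamard gen 17.  `PrimeSquareOrder` (gen 11) excludes `p²`
dividing the order of the permutation pair of a signed automorphism for the primes `p ≥ 11` of the spectrum; for
`p = 7` order `49` is NOT excluded by counting (the window `f ∈ {24, …, 80}` of `census7` allows `668 = 80 + 49·12`).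
One step up it is: **`hadamard668_signedAut_not_dvd_orderOf_343`** — `7³ ∤ orderOf (π, κ)` for every signed
automorphism `(π, κ, d, e)` of a Hadamard matrix of order `668`.  PROOF.  A power has pair-order exactly `343`; its
`49`-th power `(ρ, τ)` has `ρ⁷ = τ⁷ = 1` and `ρ ≠ 1` (`signedAut_snd_eq_one` on the transpose if only `τ ≠ 1`), so
`ρ` fixes `f ∈ {24, 38, 52, 66, 80}` rows (`census7`); but the rows moved by `ρ = π'^49` carry a free action of
`⟨π'⟩ ≅ ℤ/343` (`free_of_moved_prime_pow`: a point of period dividing `gcd(j, 7³) ∣ 49` would be fixed by `π'^49`),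
so `343 ∣ 668 − f ∈ [588, 644]` (`prime_pow_dvd_card_moved`, via `dvd_card_of_free`) — impossible.
WORDS (with `ElemAbelianSummary668C`): no `C₇ × C₇` and no element of order `343`; on paper (a `7`-group without
`C₇ × C₇` is cyclic, `p` odd) the Sylow `7`-subgroups of the signed automorphism group of any H(668) are cyclic of
order dividing `49`; order `49` itself remains open.  Ours, not literature; no `sorry`.
-/

namespace Summit.Ventures.DiscreteObjects.Hadamard

open Finset BigOperators Matrix

open Literature.Combinatorics.Designs.GoethalsSeidel (IsHadamardMatrix)

variable {ι : Type*} [Fintype ι] [DecidableEq ι]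

omit [Fintype ι] [DecidableEq ι] in
/-- **a point moved by `κ^(p^k)` is free for `κ` below `p^(k+1)`** (when `κ^(p^(k+1)) = 1`, `p` prime): a period `j`
would give the period `gcd(j, p^(k+1)) = p^i` with `i ≤ k`, hence the period `p^k`. -/
lemma free_of_moved_prime_pow (κ : Equiv.Perm ι) {p k : ℕ} (hp : p.Prime) (hκ : κ ^ (p ^ (k + 1)) = 1) {y : ι}
    (hy : (κ ^ (p ^ k)) y ≠ y) : ∀ j, 0 < j → j < p ^ (k + 1) → (κ ^ j) y ≠ y := by
  intro j hj0 hj hfix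
  have h1 : Function.IsPeriodicPt κ j y := by
    show (⇑κ)^[j] y = y
    rw [Equiv.Perm.iterate_eq_pow]; exact hfix
  have h2 : Function.IsPeriodicPt κ (p ^ (k + 1)) y := by
    show (⇑κ)^[p ^ (k + 1)] y = y
    rw [Equiv.Perm.iterate_eq_pow, hκ]; rfl
  have h3 := h1.gcd h2
  obtain ⟨i, hi, hgi⟩ := (Nat.dvd_prime_pow hp).1 (Nat.gcd_dvd_right j (p ^ (k + 1)))
  have hik : i ≤ k := by
    by_contra hik'
    have hi' : i = k + 1 := by omega
    rw [hi'] at hgi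
    have hdj : p ^ (k + 1) ∣ j := hgi ▸ Nat.gcd_dvd_left j (p ^ (k + 1))
    exact absurd (Nat.le_of_dvd hj0 hdj) (not_le.2 hj)
  have h4 : Function.IsPeriodicPt κ (p ^ k) y := by
    have h5 := h3.mul_const (p ^ (k - i))
    rw [hgi, ← pow_add, Nat.add_sub_cancel' hik] at h5
    exact h5
  apply hy
  have h6 : (⇑κ)^[p ^ k] y = y := h4
  rw [Equiv.Perm.iterate_eq_pow] at h6
  exact h6

/-- **`p^(k+1)` divides the number of points moved by `κ^(p^k)`** when `κ^(p^(k+1)) = 1`. -/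
lemma prime_pow_dvd_card_moved (κ : Equiv.Perm ι) {p k : ℕ} (hp : p.Prime) (hκ : κ ^ (p ^ (k + 1)) = 1) :
    p ^ (k + 1) ∣ (univ.filter fun y => (κ ^ (p ^ k)) y ≠ y).card := by
  apply dvd_card_of_free κ (pow_pos hp.pos _) hκ _ _ le_rfl
  · intro y hy
    simp only [Finset.mem_filter, Finset.mem_univ, true_and] at hy ⊢
    rw [pow_apply_comm κ (p ^ k) y]
    exact fun h => hy (κ.injective h)
  · intro y hy
    simp only [Finset.mem_filter, Finset.mem_univ, true_and] at hy
    exact free_of_moved_prime_pow κ hp hκ hy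

section main
variable {H : Matrix ι ι ℤ}

/-- **No signed automorphism of an H(668) whose permutation pair has order divisible by `343 = 7³`.** -/
theorem hadamard668_signedAut_not_dvd_orderOf_343 (hH : IsHadamardMatrix H) (hι : Fintype.card ι = 668)
    (π κ : Equiv.Perm ι) (d e : ι → ℤ) (haut : IsSignedAut H π κ d e)
    (hdvd : 7 ^ 3 ∣ orderOf ((π, κ) : Equiv.Perm ι × Equiv.Perm ι)) : False := by
  have hcard : (Fintype.card ι : ℤ) ≠ 0 := by rw [hι]; norm_num
  -- a power of pair-order exactly 343
  set x : Equiv.Perm ι × Equiv.Perm ι := (π, κ) with hx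
  have hx0 : orderOf x ≠ 0 := (orderOf_pos x).ne'
  set k := orderOf x / 7 ^ 3 with hk
  have hord : orderOf (x ^ k) = 7 ^ 3 := orderOf_pow_orderOf_div hx0 hdvd
  have hxk : x ^ k = ((π ^ k, κ ^ k) : Equiv.Perm ι × Equiv.Perm ι) := by rw [hx, Prod.pow_mk]
  rw [hxk] at hord
  obtain ⟨h1, -, h3⟩ := pow_data_of_orderOf hord (a := 7 ^ 2) (by norm_num) (by norm_num)
  have haut' := isSignedAut_pow haut k
  -- the 49-th power (ρ, τ): exponent 7, ρ ≠ 1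
  have haut49 := isSignedAut_pow haut' (7 ^ 2)
  have hρ7 : ((π ^ k) ^ 7 ^ 2) ^ 7 = 1 := by rw [← pow_mul]; exact h1
  have hτ7 : ((κ ^ k) ^ 7 ^ 2) ^ 7 = 1 := by
    obtain ⟨-, h2, -⟩ := pow_data_of_orderOf hord (a := 7 ^ 2) (by norm_num) (by norm_num)
    rw [← pow_mul]; exact h2
  have hρne : (π ^ k) ^ 7 ^ 2 ≠ 1 := by
    rcases h3 with h | h
    · exact h
    · intro hρ
      apply h
      rw [hρ] at haut49
      exact signedAut_snd_eq_one H hH hcard haut49 (by decide : Odd 7) hτ7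
  -- census: f ∈ {24, 38, 52, 66, 80} rows fixed by ρ
  obtain ⟨-, hcen⟩ := census7 hH hι haut49 hρ7 hτ7 hρne
  -- 343 divides the number of rows moved by ρ = (π^k)^(7^2)
  have hdvd' := prime_pow_dvd_card_moved (π ^ k) (k := 2) (by norm_num : (7 : ℕ).Prime) h1
  have hsplit := Finset.card_filter_add_card_filter_not (s := (univ : Finset ι))
    (fun i => ((π ^ k) ^ 7 ^ 2) i = i)
  rw [Finset.card_univ, hι] at hsplit
  have e : (univ.filter fun i => ((π ^ k) ^ 7 ^ 2) i ≠ i) = univ.filter fun i => ¬ ((π ^ k) ^ 7 ^ 2) i = i := rfl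
  rw [e] at hdvd'
  obtain ⟨c, hc⟩ := hdvd'
  rw [show (7 : ℕ) ^ 3 = 343 from rfl] at hc
  omega

end main

end Summit.Ventures.DiscreteObjects.Hadamard
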